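import Summits.KontsevichZagierPeriods.KontsevichZagierPeriods.Theorems.SoloBlindDilog
import Summits.KontsevichZagierPeriods.KontsevichZagierPeriods.Theorems.SoloBlindHomogeneous
import Summits.KontsevichZagierPeriods.KontsevichZagierPeriods.Theorems.SoloBlindSerret
import HarnessLib

/-!
# The degree-two sector at `μ = 2`: `Λ₂`, `D`, `ℓ × ℓ`, `L × A`, Serret — unconditionally

Solo programme `solo-KontsevichZagierPeriods-blind`, session 5.

`H₂(2)` is the homogeneous sector of degree `2` in `(x_π, ℓ(2))` (`SoloBlindHomogeneous`): the
integral representations whose class in `Q` is a `K₀`-combination of `x_π²`, `x_π ℓ(2)`,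
`ℓ(2)²`.  By Gelfond–Schneider (`π / log 2` is transcendental) the period map is injective on
it, so the Kontsevich–Zagier conjecture holds for every pair of its members (`kz_homSector`).

This file populates `H₂(2)` with the classical two-dimensional integrals of the programme:

* Kontsevich's `Λ₂ = Z` (`[Λ₂] = 6⁻¹ x_π²`), the unit square `S`;
* the square `ℓ × ℓ` of the log-2 cell and the mixed product `L × A` (`(π/4) log 2`);
* **Euler's dilogarithm box** `D = [0<t₁<t₀<½, dt/(t₀(1-t₁))]` (period `Li₂(½)`): by the four
  moves of `SoloBlindDilog`, `[D] = 2⁻¹([Λ₂] - ℓ(2)²) = 12⁻¹ x_π² - 2⁻¹ ℓ(2)²`;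
* **Serret's integral** `[kzSerret, 1/(x(1+y²))]` (period `π log 2 / 8`): by the chart of
  `SoloBlindSerret`, `[Serret] = 2⁻¹ [L × A] = 8⁻¹ x_π ℓ(2)`.

Consequently (`kz_dilogRep`, `kz_serretRep`) `D` and Serret's integral are KZ-equivalent to
every representation in `H₂(2)` with the same period — **unconditionally**.  In session 2
(`SoloBlindSerret.kz_serret`) the Serret statement was obtained on the inhomogeneous box ring
only under the conjecture `AlgIndepLogarithms`; restricting to the homogeneous degree-two part,
Gelfond–Schneider replaces the conjecture.
-/

noncomputable section

namespace Summit.KontsevichZagierPeriods.KontsevichZagierPeriods.Theorems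

namespace SoloBlind

open Set MeasureTheory
open Literature.NumberTheory.Transcendental
open Literature.NumberTheory.Transcendental.KZ

/-- The class of the log-2 cell is the generator `ℓ(2)`. -/
theorem mkQ_logTwoCell : mkQ (of logTwoCell) = ell 2 := by
  rw [ell_eq (show IsAlgebraic ℚ (2:ℝ) from isAlgebraic_nat 2), logTwoCell,
    logCell_congr (hc' := isAlgebraic_one)
      (hl' := (show IsAlgebraic ℚ (2:ℝ) from isAlgebraic_nat 2)) Rat.cast_one rfl]

/-- The class of the unit arctangent cell is the generator `a(1)` (`x_π = 4 a(1)`). -/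
theorem mkQ_atanOneCell : mkQ (of atanOneCell) = alpha 1 := by
  rw [alpha_eq isAlgebraic_one, atanOneCell,
    atanCell_congr (hd' := isAlgebraic_one) (hτ' := isAlgebraic_one) Rat.cast_one rfl]

/-! ## Members of `H₂(2)` -/

/-- `Λ₂ ∈ H₂(μ)` for every `μ` (it is equivalent to `Z`, whose class is `6⁻¹ x_π²`). -/
theorem of_simplexTwo_mem_homSector (μ : ℝ) : of simplexTwo ∈ homSector μ 2 :=
  mem_modSector_of_equivalent simplexTwo_equiv_zetaTwoRep (of_zetaTwoRep_mem_homSector μ)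

/-- `ℓ × ℓ ∈ H₂(2)` (class `ℓ(2)²`). -/
theorem of_logTwoCell_prod_self_mem_homSector :
    of (logTwoCell.prod logTwoCell) ∈ homSector 2 2 := by
  refine mem_modSector_of_mkQ_eq 0 1 ?_
  rw [← of_mul_of, mkQ_mul, mkQ_logTwoCell, one_smul, homGen]
  simp [sq]

/-- `L × A ∈ H₂(2)` (class `ℓ(2) a(1) = 4⁻¹ x_π ℓ(2)`). -/
theorem of_logTwoCell_prod_atanOneCell_mem_homSector :
    of (logTwoCell.prod atanOneCell) ∈ homSector 2 2 := by
  refine mem_modSector_of_mkQ_eq 1 (4 : K₀)⁻¹ ?_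
  rw [← of_mul_of, mkQ_mul, mkQ_logTwoCell, mkQ_atanOneCell, homGen, xPi,
    eq_inv_smul_iff₀ (by norm_num : (4 : K₀) ≠ 0)]
  simp [mul_comm]

/-- The class of the dilogarithm box: `[D] = 2⁻¹ • ([Λ₂] - [ℓ × ℓ])`. -/
theorem mkQ_dilogRep : mkQ (of dilogRep) =
    (2 : K₀)⁻¹ • (mkQ (of simplexTwo) - mkQ (of (logTwoCell.prod logTwoCell))) := by
  rw [eq_inv_smul_iff₀ (two_ne_zero (α := K₀)), mkQ_simplexTwo, ← of_mul_of, mkQ_mul, ← sq,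
    add_sub_cancel_right, ofNat_smul_eq_nsmul]

/-- **`D ∈ H₂(2)`**: `[D] = 12⁻¹ x_π² - 2⁻¹ ℓ(2)²`. -/
theorem of_dilogRep_mem_homSector : of dilogRep ∈ homSector 2 2 := by
  rw [mem_modSector, mkQ_dilogRep]
  exact Submodule.smul_mem _ _ (sub_mem (mem_modSector.mp (of_simplexTwo_mem_homSector 2))
    (mem_modSector.mp of_logTwoCell_prod_self_mem_homSector))

/-- The class of Serret's integral: `[Serret] = 2⁻¹ • [L × A]`. -/
theorem mkQ_serretRep :
    mkQ (of serretRep) = (2 : K₀)⁻¹ • mkQ (of (logTwoCell.prod atanOneCell)) := by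
  rw [eq_inv_smul_iff₀ (two_ne_zero (α := K₀)), ofNat_smul_eq_nsmul, two_smul_mkQ_serretRep,
    ← mkQ_mul, of_mul_of]

/-- **Serret's integral lies in `H₂(2)`**: `[Serret] = 8⁻¹ x_π ℓ(2)`. -/
theorem of_serretRep_mem_homSector : of serretRep ∈ homSector 2 2 := by
  rw [mem_modSector, mkQ_serretRep]
  exact Submodule.smul_mem _ _ (mem_modSector.mp of_logTwoCell_prod_atanOneCell_mem_homSector)

/-- Serret's reflected integral `S'` lies in `H₂(2)` as well. -/
theorem of_serretRep'_mem_homSector : of serretRep' ∈ homSector 2 2 :=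
  mem_modSector_of_equivalent equivalent_serret_serret'.symm of_serretRep_mem_homSector

/-! ## The Kontsevich–Zagier conjecture for `D` and for Serret's integral, unconditionally -/

/-- **KZ for Euler's dilogarithm box.**  `D` is KZ-equivalent to every integral representation in
`H₂(2)` with period `Li₂(½) = π²/12 - log²2/2` — any `K₀`-combination of `Z`, `S`, `Λ₂`,
`ℓ × ℓ`, `L × A`, Serret, … with that value. -/
theorem kz_dilogRep {m : ℕ} (r' : IntegralRep m) (hr' : of r' ∈ homSector 2 2)
    (hv : r'.value = Real.pi ^ 2 / 12 - Real.log 2 ^ 2 / 2) : Equivalent dilogRep r' :=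
  kz_homSector (show IsAlgebraic ℚ (2:ℝ) from isAlgebraic_nat 2) one_lt_two dilogRep r'
    of_dilogRep_mem_homSector hr'
    (by rw [dilogRep_value, hv])

/-- **KZ for Serret's integral, unconditionally** (compare the conditional
`SoloBlindSerret.kz_serret`): Serret's `[kzSerret, 1/(x(1+y²))]` is KZ-equivalent to every
representation in `H₂(2)` with period `π log 2 / 8`. -/
theorem kz_serretRep {m : ℕ} (r' : IntegralRep m) (hr' : of r' ∈ homSector 2 2)
    (hv : r'.value = Real.pi * Real.log 2 / 8) : Equivalent serretRep r' :=
  kz_homSector (show IsAlgebraic ℚ (2:ℝ) from isAlgebraic_nat 2) one_lt_two serretRep r'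
    of_serretRep_mem_homSector hr'
    (by rw [serretRep_value, hv])

/-- **KZ on `H₂(2)`, general form**, recorded with the membership lemmas of this file in scope:
two representations among the `K₀`-span of `{Z, S, Λ₂, D, ℓ × ℓ, L × A, Serret, Serret'}` with
equal periods are KZ-equivalent. -/
theorem kz_degreeTwo_logTwo {n m : ℕ} (r : IntegralRep n) (r' : IntegralRep m)
    (hr : of r ∈ homSector 2 2) (hr' : of r' ∈ homSector 2 2) (hv : r.value = r'.value) :
    Equivalent r r' :=
  kz_homSector (show IsAlgebraic ℚ (2:ℝ) from isAlgebraic_nat 2) one_lt_two r r' hr hr' hv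

end SoloBlind

end Summit.KontsevichZagierPeriods.KontsevichZagierPeriods.Theorems

end
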